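import Literature.AlgebraicGeometry.Motives.GaloisDescentAbelianVariety
import Literature.AlgebraicGeometry.Motives.JacobianGaloisDescent
import Mathlib.NumberTheory.NumberField.Basic
import HarnessLib

/-!
# Galois descent of an abelian variety together with a ring of endomorphisms
# (Shimura 1998, §21.1 Prop. 21.1 — the case of a constant family; Weil 1956)

Shimura, *Abelian Varieties with Complex Multiplication and Modular Functions* (1998), §21.1,
Prop. 21.1 (≈ p. 145; proof pp. 145–146): a structure `𝒫 = (A, 𝒞, ι; {tᵢ})` with isomorphisms `f_σ : 𝒫 → 𝒫^σ`
satisfying the cocycle rule `f_{στ} = (f_σ)^τ ∘ f_τ` over a finite Galois extension descends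
("applying a well-known criterion of Weil [55, Theorem 3] … we find a variety `B` rational over `k₀`
and a biregular map `f` of `B` to `A` … such that `f_σ = f^σ ∘ f⁻¹`"), and the endomorphisms
`ι(a)` descend with it.  This is the step "by Prop. 21.1 the family descends to a structure `𝒫₁`
rational over `k`" at the end of the proof of Thm. 21.4 (Casselman's theorem, pp. 147–148).

In the vocabulary of the tree (Galois-typed): let `L / k` be finite Galois, `A` an abelian variety
over `L` with a semilinear action `ρ` of `Gal(L/k)` on the `k`-scheme `A` (`ρ σ` covering
`Spec σ⁻¹`, compatible with the group law — the hypotheses of the tree's PROVED Weil descent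
`GaloisDescentAbelianVariety.exists_iso_baseChange`, Milne *Jacobian Varieties* 1.9) and
`ι : R →+* End A` a ring of endomorphisms commuting with every `ρ σ`.  Then there are an abelian
variety `A₀` over `k`, an isomorphism `e : A ≅ A₀ ⊗_k L` carrying `ρ σ` to the Galois automorphism
`1 × Spec σ⁻¹` (`AbelianVariety.gal`), and `ι₀ : R →+* End A₀` with `ι(a) = e⁻¹ ∘ ι₀(a)_L ∘ e`:

* `exists_descent_with_ringHom` — for an arbitrary (semi)ring `R`;
* `exists_descent_with_end` — the same for `R = 𝓞 K`, `K` a field (the binder shape consumed by the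
  CM-structure descent of Shimura Thm. 21.4).

Proof: `(A₀, e)` is the tree's Weil descent; for each `a`, `e⁻¹ ≫ ι(a) ≫ e ∈ End(A₀ ⊗ L)` commutes
with the Galois automorphisms (because `e` intertwines `ρ` with `gal` and `ι(a)` commutes with `ρ`),
hence is the base change of a unique endomorphism of `A₀` (Galois descent of homomorphisms of
abelian varieties along a finite Galois extension, `AbelianVariety.galoisDescent` /
`baseChange_galoisDescent` of `Motives/JacobianGaloisDescent`, Görtz–Wedhorn I Thm. 14.72 (1));
the ring axioms for `ι₀` hold after the faithful base change (`AbelianVariety.eq_of_baseChange_eq`).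
Everything is proved; no named fact.  Not here: polarisations `𝒞` and level structures `tᵢ`
(not needed by the consumer), and the field of moduli.

## References

* [Shimura1998] G. Shimura, *Abelian Varieties with Complex Multiplication and Modular Functions*,
  Princeton (1998): §21.1 Prop. 21.1 (≈ p. 145; proof pp. 145–146), §21.4 (pp. 147–148).
* [Weil1956] A. Weil, *The field of definition of a variety*, Amer. J. Math. 78 (1956), Thm. 3.
* [Milne1986JacobianVarieties] J. S. Milne, *Jacobian Varieties* (1986), §1, 1.9.
* [GortzWedhorn2020] U. Görtz, T. Wedhorn, *Algebraic Geometry I*, 2nd ed., Thm. 14.72 (1), §(14.20).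
-/

noncomputable section

open CategoryTheory CategoryTheory.Limits AlgebraicGeometry MonoidalCategory CartesianMonoidalCategory
open Literature.AlgebraicGeometry.RelativeSpec
open scoped NumberField

universe u v

namespace Literature.AlgebraicGeometry.Motives

namespace AbelianVariety

open scoped MonObj

set_option backward.isDefEq.respectTransparency false

variable {k : Type u} [Field k] (L : Type u) [Field L] [Algebra k L] [FiniteDimensional k L]
  [IsGalois k L] (A : AbelianVariety L)
  (ρ : ActionOver (A.X.hom ≫ bcSpec k L) (L ≃ₐ[k] L))
  (hρ : ∀ σ : L ≃ₐ[k] L, (ρ.aut σ).hom ≫ A.X.hom = A.X.hom ≫ specAut L σ⁻¹)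
  (hmul : ∀ σ : L ≃ₐ[k] L,
    GaloisDescentAbelianVariety.aut₂ L A ρ hρ σ ≫ μ[A.X].left = μ[A.X].left ≫ (ρ.aut σ).hom)
  (hone : ∀ σ : L ≃ₐ[k] L, η[A.X].left ≫ (ρ.aut σ).hom = specAut L σ⁻¹ ≫ η[A.X].left)
  (hinv : ∀ σ : L ≃ₐ[k] L, ι[A.X].left ≫ (ρ.aut σ).hom = (ρ.aut σ).hom ≫ ι[A.X].left)

omit [FiniteDimensional k L] [IsGalois k L] in
/-- **Transport of a `ρ`-equivariant endomorphism along an equivariant isomorphism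
`e : A ≅ A₀ ⊗_k L` commutes with the Galois automorphisms of `A₀ ⊗_k L`.**  If `e` carries `ρ σ` to
`gal σ = 1 × Spec σ⁻¹` and the scheme endomorphism underlying `f : A → A` commutes with every
`ρ σ`, then `e⁻¹ ≫ f ≫ e` commutes with every `gal σ` on schemes (private plumbing for
`exists_descent_with_ringHom`). [folklore] -/
private theorem gal_comp_toSchemeHom_conj_of_equivariant {A₀ : AbelianVariety k} (e : A ≅ A₀.baseChange L)
    (he : ∀ σ : L ≃ₐ[k] L, (ρ.aut σ).hom ≫ Hom.toSchemeHom e.hom = Hom.toSchemeHom e.hom ≫ A₀.gal L σ)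
    (f : A ⟶ A) (hf : ∀ σ : L ≃ₐ[k] L, (ρ.aut σ).hom ≫ Hom.toSchemeHom f = Hom.toSchemeHom f ≫ (ρ.aut σ).hom)
    (σ : L ≃ₐ[k] L) :
    A₀.gal L σ ≫ Hom.toSchemeHom (e.inv ≫ f ≫ e.hom) =
      Hom.toSchemeHom (e.inv ≫ f ≫ e.hom) ≫ A₀.gal L σ := by
  have hcomp : ∀ {P Q R : AbelianVariety L} (a : P ⟶ Q) (b : Q ⟶ R),
      Hom.toSchemeHom (a ≫ b) = Hom.toSchemeHom a ≫ Hom.toSchemeHom b := fun _ _ ↦ rfl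
  have h1 : Hom.toSchemeHom e.hom ≫ Hom.toSchemeHom e.inv = 𝟙 _ := by
    rw [← hcomp, Iso.hom_inv_id]; rfl
  have h2 : Hom.toSchemeHom e.inv ≫ Hom.toSchemeHom e.hom = 𝟙 _ := by
    rw [← hcomp, Iso.inv_hom_id]; rfl
  -- equivariance of `e⁻¹`
  have he' : A₀.gal L σ ≫ Hom.toSchemeHom e.inv = Hom.toSchemeHom e.inv ≫ (ρ.aut σ).hom := by
    have h3 : (Hom.toSchemeHom e.inv ≫ Hom.toSchemeHom e.hom) ≫ A₀.gal L σ ≫ Hom.toSchemeHom e.inv =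
        Hom.toSchemeHom e.inv ≫ (ρ.aut σ).hom ≫ Hom.toSchemeHom e.hom ≫ Hom.toSchemeHom e.inv := by
      rw [Category.assoc, ← reassoc_of% (he σ)]
    rw [h2, Category.id_comp, h1, Category.comp_id] at h3
    exact h3
  rw [hcomp, hcomp, reassoc_of% he', Category.assoc, Category.assoc, reassoc_of% (hf σ), he σ]

include hρ hmul hone hinv in
/-- **Galois descent of an abelian variety with a ring of endomorphisms** (Shimura 1998, §21.1
Prop. 21.1 for the constant family `R(σ) = 𝒫`, via Weil 1956 Thm. 3; here from the tree's Weil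
descent of abelian varieties and Galois descent of homomorphisms).  Let `L / k` be finite Galois,
`A / L` an abelian variety with a semilinear `Gal(L/k)`-action `ρ` compatible with its group law,
and `ι : R →+* End A` endomorphisms commuting with every `ρ σ`.  Then there are `A₀ / k`, an
isomorphism `e : A ≅ A₀ ⊗_k L` carrying `ρ σ` to `1 × Spec σ⁻¹`, and `ι₀ : R →+* End A₀` with
`ι(a) ≫ e = e ≫ ι₀(a)_L` for all `a`. [cite: Shimura1998, §21.1 Prop. 21.1 (≈ p. 145; proof pp. 145–146)] -/
theorem exists_descent_with_ringHom {R : Type v} [Semiring R] (ι₂ : R →+* End A)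
    (hι : ∀ (σ : L ≃ₐ[k] L) (a : R), (ρ.aut σ).hom ≫ Hom.toSchemeHom (ι₂ a : A ⟶ A) =
      Hom.toSchemeHom (ι₂ a : A ⟶ A) ≫ (ρ.aut σ).hom) :
    ∃ (A₀ : AbelianVariety k) (e : A ≅ A₀.baseChange L) (ι₀ : R →+* End A₀),
      (∀ σ : L ≃ₐ[k] L, (ρ.aut σ).hom ≫ Hom.toSchemeHom e.hom =
          Hom.toSchemeHom e.hom ≫ A₀.gal L σ) ∧
      (∀ a : R, (ι₂ a : A ⟶ A) ≫ e.hom = e.hom ≫ Hom.baseChange L (ι₀ a : A₀ ⟶ A₀)) := by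
  obtain ⟨A₀, e, he⟩ := GaloisDescentAbelianVariety.exists_iso_baseChange L A ρ hρ hmul hone hinv
  -- the transported endomorphisms of `A₀ ⊗ L` and their descents
  let r : R → (A₀.baseChange L ⟶ A₀.baseChange L) := fun a ↦ e.inv ≫ (ι₂ a : A ⟶ A) ≫ e.hom
  have hr : ∀ (a : R) (σ : L ≃ₐ[k] L),
      A₀.gal L σ ≫ Hom.toSchemeHom (r a) = Hom.toSchemeHom (r a) ≫ A₀.gal L σ :=
    fun a σ ↦ gal_comp_toSchemeHom_conj_of_equivariant L A ρ e he (ι₂ a) (fun τ ↦ hι τ a) σ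
  let f : R → End A₀ := fun a ↦ galoisDescent L A₀ A₀ (r a) (hr a)
  have hf : ∀ a, Hom.baseChange L (f a) = e.inv ≫ (ι₂ a : A ⟶ A) ≫ e.hom :=
    fun a ↦ baseChange_galoisDescent L A₀ A₀ (r a) (hr a)
  let ι₀ : R →+* End A₀ :=
    { toFun := f
      map_one' := by
        refine eq_of_baseChange_eq L A₀ A₀ ?_
        rw [hf, map_one, End.one_def, End.one_def, Hom.baseChange_id, Category.id_comp,
          Iso.inv_hom_id]
      map_mul' := fun a b ↦ by
        refine eq_of_baseChange_eq L A₀ A₀ ?_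
        rw [hf, map_mul, End.mul_def, End.mul_def, Hom.baseChange_comp, hf, hf]
        simp only [Category.assoc, Iso.hom_inv_id_assoc]
      map_zero' := by
        refine eq_of_baseChange_eq L A₀ A₀ ?_
        rw [hf, map_zero]
        change e.inv ≫ (0 : A ⟶ A) ≫ e.hom = Hom.baseChange L (0 : A₀ ⟶ A₀)
        rw [Limits.zero_comp, Limits.comp_zero]
        -- `0_L = 0` from additivity of base change
        have h := Hom.baseChange_add L (0 : A₀ ⟶ A₀) 0
        rw [add_zero] at h
        exact (left_eq_add.mp h).symm
      map_add' := fun a b ↦ by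
        refine eq_of_baseChange_eq L A₀ A₀ ?_
        rw [hf, map_add]
        change e.inv ≫ ((ι₂ a : A ⟶ A) + (ι₂ b : A ⟶ A)) ≫ e.hom =
          Hom.baseChange L ((f a : A₀ ⟶ A₀) + (f b : A₀ ⟶ A₀))
        rw [Hom.baseChange_add, hf, hf, Preadditive.add_comp, Preadditive.comp_add] }
  refine ⟨A₀, e, ι₀, he, fun a ↦ ?_⟩
  change (ι₂ a : A ⟶ A) ≫ e.hom = e.hom ≫ Hom.baseChange L (f a)
  rw [hf, Iso.hom_inv_id_assoc]

include hρ hmul hone hinv in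
/-- **Weil descent of a structure `(A, ι)` with `ι : 𝓞_K → End A`** (Shimura 1998, §21.1
Prop. 21.1, as used at the end of the proof of Thm. 21.4, pp. 147–148: "by Prop. 21.1 … a structure
`𝒫₁` rational over `k`"): for `L / k` finite Galois, an abelian variety `A / L` with a semilinear
`Gal(L/k)`-action compatible with its group law and an `𝓞_K`-action commuting with it descend
together to `(A₀ / k, ι₀ : 𝓞_K → End A₀)`, `ι(a) = e⁻¹ ∘ ι₀(a)_L ∘ e`.
[cite: Shimura1998, §21.1 Prop. 21.1 (≈ p. 145; proof pp. 145–146) and §21.4 (pp. 147–148)] -/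
theorem exists_descent_with_end (K : Type v) [Field K] (ι₂ : 𝓞 K →+* End A)
    (hι : ∀ (σ : L ≃ₐ[k] L) (a : 𝓞 K), (ρ.aut σ).hom ≫ Hom.toSchemeHom (ι₂ a : A ⟶ A) =
      Hom.toSchemeHom (ι₂ a : A ⟶ A) ≫ (ρ.aut σ).hom) :
    ∃ (A₀ : AbelianVariety k) (e : A ≅ A₀.baseChange L) (ι₀ : 𝓞 K →+* End A₀),
      (∀ σ : L ≃ₐ[k] L, (ρ.aut σ).hom ≫ Hom.toSchemeHom e.hom =
          Hom.toSchemeHom e.hom ≫ A₀.gal L σ) ∧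
      (∀ a : 𝓞 K, (ι₂ a : A ⟶ A) ≫ e.hom = e.hom ≫ Hom.baseChange L (ι₀ a : A₀ ⟶ A₀)) :=
  exists_descent_with_ringHom L A ρ hρ hmul hone hinv ι₂ hι

end AbelianVariety

end Literature.AlgebraicGeometry.Motives

end
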